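import Mathlib
import Summits.NavierStokesRegularity.NavierStokesRegularity.Theorems.EulerZoomLiouvillePowerGaugeEulerLiouvilleSelfSimilarTopBadNodeHyperbolic
import HarnessLib.Audit

/-!
# Rung C1 of the crux `EulerZoomLiouville.PowerGaugeEulerLiouville`: landscape tools for the no-exit lemma at the
# top bad node — Lipschitz velocity gradient, the off-node Bernoulli expansion, the bump lemma

Route №10 `EulerZoomLiouville` (NavierStokesRegularity), crux E = stmt-NavierStokesRegularity-19832,
tenure rung C1 (exactly self-similar members), registered residue `stub_selfSimilarExtremal`.
Seventeenth file of the NODAL-CONTINUUM line (lineage ns-typeII-p1, gen 7): inventory items (i) and (v) of the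
no-exit lemma (evidence NO-EXIT-LEMMA on the crux item), for a `C²` stationary self-similar Euler profile `(U, P)`
(CIV 2026 (3.3); `V = γ(y−c) + U`, `ℋ` the Bernoulli function (3.30)):

* `exists_lipschitz_fderiv_velocity` — `DU` is Lipschitz on a ball about any point (`U ∈ C²`, mean value);
* `selfSimilarBernoulli_expansion_offNode` — **second-order expansion of `ℋ` at an ARBITRARY point `y` near a
  non-vortical `z`, with the linear term**: `ℋ(y + ζ) ≥ ℋ(y) + Dℋ(y)[ζ] + ½(2γ−1)⟪DV(z)ζ, ζ⟫ − (ν + C|V(y)|)|ζ|²` for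
  `|y − z|, |ζ| ≤ δ(ν)` (two-point linearisation of `V`, Lipschitz `DU`, symmetry of `DU(z)`); along the kernel-line graph
  through the top bad node this is the exit inequality when the exit point's base is not a node;
* `bump_of_sq_bound` — **bump lemma**: if `|φ(σ) − φ(σ')| ≤ ℓ|σ − σ'|` on `[0, b]`, `|φ(σ)| ≤ C₁σ²` there and `C₁ b ≤ ℓ`,
  then `|φ| ≥ |φ(σ_*)|/2` on `[σ_* − |φ(σ_*)|/(2ℓ), σ_*] ⊆ [σ_*/2, σ_*]`.

WHAT THIS IS NOT: not NS, not E, not rung C1 — calculus bookkeeping for classical profiles.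
References: P. Constantin, M. Ignatova, V. Vicol, arXiv:2602.17570 (2026), §3.4.3 (3.29)–(3.31) [ConstantinIgnatovaVicol2026Putative].
-/

noncomputable section

-- flat `Theorems/<Route><Decl>…` files of one crux share the namespace of the crux (tree convention)
set_option linter.dupNamespace false

open Set Filter Topology Metric Function InnerProductSpace
open scoped RealInnerProductSpace NNReal

namespace Summit.NavierStokesRegularity.NavierStokesRegularity.Theorems.PowerGaugeEulerLiouville.NodalContinuum

open Literature.Analysis Literature.Analysis.FluidPDE Literature.Analysis.ODE
open Summit.NavierStokesRegularity.NavierStokesRegularity.Theorems.PowerGaugeEulerLiouville.NodalFiniteness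

variable {γ : ℝ} {c : EuclideanSpace ℝ (Fin 3)}
  {U : EuclideanSpace ℝ (Fin 3) → EuclideanSpace ℝ (Fin 3)} {P : EuclideanSpace ℝ (Fin 3) → ℝ}

/-! ### `DU` is locally Lipschitz -/

/-- **`DU` is Lipschitz on a ball** (`U ∈ C²`: the second derivative is bounded on the compact ball; mean value
inequality). [folklore] -/
theorem exists_lipschitz_fderiv_velocity (h : IsSelfSimilarEulerProfile γ c U P) (z : EuclideanSpace ℝ (Fin 3))
    (R : ℝ) :
    ∃ C₂ : ℝ, 0 ≤ C₂ ∧ ∀ y ∈ closedBall z R, ∀ y' ∈ closedBall z R,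
      ‖fderiv ℝ U y - fderiv ℝ U y'‖ ≤ C₂ * ‖y - y'‖ := by
  have hDU : ContDiff ℝ 1 (fun y => fderiv ℝ U y) := h.contDiff_velocity.fderiv_right (by norm_num)
  have hd : Differentiable ℝ (fun y => fderiv ℝ U y) := hDU.differentiable (by norm_num)
  have hc : Continuous fun y => fderiv ℝ (fun y => fderiv ℝ U y) y := hDU.continuous_fderiv (by norm_num)
  obtain ⟨C, hC⟩ := (isCompact_closedBall z R).exists_bound_of_continuousOn
    (f := fun y => fderiv ℝ (fun y => fderiv ℝ U y) y) hc.continuousOn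
  refine ⟨max C 0, le_max_right _ _, fun y hy y' hy' => ?_⟩
  exact (convex_closedBall z R).norm_image_sub_le_of_norm_fderiv_le (f := fun y => fderiv ℝ U y)
    (fun x _ => hd x) (fun x hx => (hC x hx).trans (le_max_left _ _)) hy' hy

/-! ### The off-node expansion of `ℋ` -/

/-- **Second-order expansion of `ℋ` at an arbitrary point near a non-vortical `z`, with the linear term.**  Let
`(U, P)` be a `C²` profile, `curl U(z) = 0`, `A = DV(z)`.  For every `ν > 0` there are `δ > 0` and `C ≥ 0` such that for
all `y` with `|y − z| ≤ δ` and all `|ζ| ≤ δ`: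
`ℋ(y + ζ) ≥ ℋ(y) + Dℋ(y)[ζ] + ½(2γ−1)⟪Aζ, ζ⟫ − (ν + C|V(y)|)|ζ|²`.
[cite: ConstantinIgnatovaVicol2026Putative, §3.4.3 eq. (3.29)–(3.31) (second variation off the nodal set; not in print)] -/
theorem selfSimilarBernoulli_expansion_offNode (h : IsSelfSimilarEulerProfile γ c U P)
    {z : EuclideanSpace ℝ (Fin 3)} (hΩz : curl U z = 0) {ν : ℝ} (hν : 0 < ν) :
    ∃ δ > 0, ∃ C : ℝ, 0 ≤ C ∧ ∀ y : EuclideanSpace ℝ (Fin 3), ‖y - z‖ ≤ δ →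
      ∀ ζ : EuclideanSpace ℝ (Fin 3), ‖ζ‖ ≤ δ →
        selfSimilarBernoulli γ c U P y + fderiv ℝ (selfSimilarBernoulli γ c U P) y ζ +
            (1 / 2 * ((2 * γ - 1) * ⟪fderiv ℝ (selfSimilarTransport γ c U) z ζ, ζ⟫) -
              (ν + C * ‖selfSimilarTransport γ c U y‖) * ‖ζ‖ ^ 2) ≤
          selfSimilarBernoulli γ c U P (y + ζ) := by
  set V := selfSimilarTransport γ c U with hV
  set A := fderiv ℝ V z with hAdef
  set Hb := selfSimilarBernoulli γ c U P with hHb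
  have hUd : Differentiable ℝ U := h.differentiable_velocity
  have hS := isSymmetric_fderiv_of_curl_eq_zero (hUd z) hΩz
  -- parameters
  set ρ : ℝ := min 1 (ν / (2 * (|2 * γ - 1| + 1))) with hρ
  have hρpos : 0 < ρ := lt_min one_pos (by positivity)
  have hρ1 : ρ ≤ 1 := min_le_left _ _
  have hρν : |2 * γ - 1| * ρ ≤ ν / 2 := by
    have h1 : ρ ≤ ν / (2 * (|2 * γ - 1| + 1)) := min_le_right _ _
    have h2 : |2 * γ - 1| * ρ ≤ |2 * γ - 1| * (ν / (2 * (|2 * γ - 1| + 1))) :=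
      mul_le_mul_of_nonneg_left h1 (abs_nonneg _)
    have h3 : |2 * γ - 1| * (ν / (2 * (|2 * γ - 1| + 1))) ≤ ν / 2 := by
      rw [show |2 * γ - 1| * (ν / (2 * (|2 * γ - 1| + 1))) =
        ν / 2 * (|2 * γ - 1| / (|2 * γ - 1| + 1)) by field_simp]
      have : |2 * γ - 1| / (|2 * γ - 1| + 1) ≤ 1 := by
        rw [div_le_one (by positivity)]; linarith
      calc ν / 2 * (|2 * γ - 1| / (|2 * γ - 1| + 1)) ≤ ν / 2 * 1 :=
            mul_le_mul_of_nonneg_left this (by linarith)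
        _ = ν / 2 := mul_one _
    exact h2.trans h3
  set κ : ℝ := ν / (4 * (‖A‖ + 2)) with hκ
  have hκpos : 0 < κ := by positivity
  obtain ⟨δ₁, hδ₁, hlin⟩ := exists_ball_linearisation h z hρpos
  have hDUc : ContinuousAt (fun y => fderiv ℝ U y) z :=
    (h.contDiff_velocity.continuous_fderiv (by norm_num)).continuousAt
  obtain ⟨δ₂, hδ₂, hDU⟩ := Metric.continuousAt_iff.1 hDUc κ hκpos
  obtain ⟨C₂, hC₂, hLip⟩ := exists_lipschitz_fderiv_velocity h z 1
  set δ : ℝ := min (min (δ₁ / 2) (δ₂ / 4)) (1 / 2) with hδ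
  have hδpos : 0 < δ := lt_min (lt_min (by linarith) (by linarith)) (by norm_num)
  have hδ1 : δ ≤ δ₁ / 2 := (min_le_left _ _).trans (min_le_left _ _)
  have hδ2 : δ ≤ δ₂ / 4 := (min_le_left _ _).trans (min_le_right _ _)
  have hδ3 : δ ≤ 1 / 2 := min_le_right _ _
  refine ⟨δ, hδpos, C₂, hC₂, fun y hyz ζ hζ => ?_⟩
  -- the segment stays in the balls
  have hsegnorm : ∀ s ∈ Icc (0 : ℝ) 1, ‖s • ζ‖ ≤ δ := by
    intro s hs
    rw [norm_smul, Real.norm_eq_abs, abs_of_nonneg hs.1]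
    calc s * ‖ζ‖ ≤ 1 * ‖ζ‖ := mul_le_mul_of_nonneg_right hs.2 (norm_nonneg _)
      _ ≤ δ := by rw [one_mul]; exact hζ
  have hdist : ∀ s ∈ Icc (0 : ℝ) 1, ‖y + s • ζ - z‖ ≤ 2 * δ := by
    intro s hs
    rw [show y + s • ζ - z = (y - z) + s • ζ by abel]
    exact (norm_add_le _ _).trans (by linarith [hsegnorm s hs, hyz])
  have hmem1 : ∀ s ∈ Icc (0 : ℝ) 1, y + s • ζ ∈ closedBall z δ₁ := fun s hs => by
    rw [mem_closedBall, dist_eq_norm]; linarith [hdist s hs]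
  have hymem1 : y ∈ closedBall z δ₁ := by rw [mem_closedBall, dist_eq_norm]; linarith
  have hmemU : ∀ s ∈ Icc (0 : ℝ) 1, y + s • ζ ∈ closedBall z 1 := fun s hs => by
    rw [mem_closedBall, dist_eq_norm]; linarith [hdist s hs]
  have hymemU : y ∈ closedBall z 1 := by rw [mem_closedBall, dist_eq_norm]; linarith
  have hE : ∀ s ∈ Icc (0 : ℝ) 1, ‖(V (y + s • ζ) - V y) - A (s • ζ)‖ ≤ ρ * (s * ‖ζ‖) := by
    intro s hs
    have := hlin (y + s • ζ) (hmem1 s hs) y hymem1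
    rw [← hV, ← hAdef, add_sub_cancel_left] at this
    rw [norm_smul, Real.norm_eq_abs, abs_of_nonneg hs.1] at this
    exact this
  have hu : ∀ s ∈ Icc (0 : ℝ) 1, ‖V (y + s • ζ) - V y‖ ≤ (‖A‖ + ρ) * (s * ‖ζ‖) := by
    intro s hs
    have h1 := hE s hs
    have h2 : ‖A (s • ζ)‖ ≤ ‖A‖ * (s * ‖ζ‖) := by
      have := A.le_opNorm (s • ζ)
      rwa [norm_smul, Real.norm_eq_abs, abs_of_nonneg hs.1] at this
    calc ‖V (y + s • ζ) - V y‖ = ‖A (s • ζ) + ((V (y + s • ζ) - V y) - A (s • ζ))‖ := by rw [add_sub_cancel]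
      _ ≤ ‖A (s • ζ)‖ + ‖(V (y + s • ζ) - V y) - A (s • ζ)‖ := norm_add_le _ _
      _ ≤ (‖A‖ + ρ) * (s * ‖ζ‖) := by linarith
  have hDUz : ∀ s ∈ Icc (0 : ℝ) 1, ‖fderiv ℝ U (y + s • ζ) - fderiv ℝ U z‖ ≤ κ := by
    intro s hs
    have hd : dist (y + s • ζ) z < δ₂ := by
      rw [dist_eq_norm]; linarith [hdist s hs]
    have := hDU hd
    rw [dist_eq_norm] at this
    exact this.le
  have hDUy : ∀ s ∈ Icc (0 : ℝ) 1, ‖fderiv ℝ U (y + s • ζ) - fderiv ℝ U y‖ ≤ C₂ * (s * ‖ζ‖) := by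
    intro s hs
    have := hLip (y + s • ζ) (hmemU s hs) y hymemU
    rw [add_sub_cancel_left, norm_smul, Real.norm_eq_abs, abs_of_nonneg hs.1] at this
    exact this
  -- the function along the segment
  set L₀ : ℝ := fderiv ℝ Hb y ζ with hL₀
  set g : ℝ → ℝ := fun s => Hb (y + s • ζ) with hg
  set q : ℝ := (2 * γ - 1) * ⟪A ζ, ζ⟫ - 2 * (ν + C₂ * ‖V y‖) * ‖ζ‖ ^ 2 with hq
  have hHd : Differentiable ℝ Hb := h.contDiff_selfSimilarBernoulli.differentiable one_ne_zero
  have hg' : ∀ s, HasDerivAt g (fderiv ℝ Hb (y + s • ζ) ζ) s := by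
    intro s
    have hpath : HasDerivAt (fun s : ℝ => y + s • ζ) ζ s := by
      have := ((hasDerivAt_id s).smul_const ζ).const_add y
      simpa using this
    exact (hHd (y + s • ζ)).hasFDerivAt.comp_hasDerivAt s hpath
  have hL₀eq : L₀ = (2 * γ - 1) * ⟪V y, ζ⟫ + (⟪V y, fderiv ℝ U y ζ⟫ - ⟪fderiv ℝ U y (V y), ζ⟫) := by
    rw [hL₀, h.fderiv_selfSimilarBernoulli_apply y ζ]
  have hlow : ∀ s ∈ Ioo (0 : ℝ) 1, L₀ + s * q ≤ fderiv ℝ Hb (y + s • ζ) ζ := by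
    intro s hs
    have hs' : s ∈ Icc (0 : ℝ) 1 := ⟨hs.1.le, hs.2.le⟩
    set w := y + s • ζ with hw
    rw [h.fderiv_selfSimilarBernoulli_apply w ζ, hL₀eq]
    set u := V w - V y with hudef
    set Es := u - A (s • ζ) with hEs
    have hEsn : ‖Es‖ ≤ ρ * (s * ‖ζ‖) := hE s hs'
    have hun : ‖u‖ ≤ (‖A‖ + ρ) * (s * ‖ζ‖) := hu s hs'
    have hVw : V w = V y + s • A ζ + Es := by rw [hEs, hudef, map_smul]; abel
    set T : ℝ := s * ‖ζ‖ * ‖ζ‖ with hT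
    have hTnn : 0 ≤ T := mul_nonneg (mul_nonneg hs.1.le (norm_nonneg _)) (norm_nonneg _)
    -- term 1
    have h1 : (2 * γ - 1) * ⟪V y, ζ⟫ + (2 * γ - 1) * (s * ⟪A ζ, ζ⟫) - |2 * γ - 1| * ρ * T ≤
        (2 * γ - 1) * ⟪V w, ζ⟫ := by
      rw [hVw, inner_add_left, inner_add_left, inner_smul_left]
      simp only [conj_trivial]
      have hb : |⟪Es, ζ⟫| ≤ ρ * T := by
        rw [hT, show ρ * (s * ‖ζ‖ * ‖ζ‖) = ρ * (s * ‖ζ‖) * ‖ζ‖ by ring]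
        exact (abs_real_inner_le_norm _ _).trans (mul_le_mul_of_nonneg_right hEsn (norm_nonneg _))
      have hprod : |(2 * γ - 1) * ⟪Es, ζ⟫| ≤ |2 * γ - 1| * (ρ * T) := by
        rw [abs_mul]; exact mul_le_mul_of_nonneg_left hb (abs_nonneg _)
      have := neg_abs_le ((2 * γ - 1) * ⟪Es, ζ⟫)
      nlinarith [this, hprod]
    -- term 2: commutators
    have h2 : (⟪V y, fderiv ℝ U y ζ⟫ - ⟪fderiv ℝ U y (V y), ζ⟫) -
        (2 * (‖A‖ + ρ) * κ + 2 * C₂ * ‖V y‖) * T ≤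
        ⟪V w, fderiv ℝ U w ζ⟫ - ⟪fderiv ℝ U w (V w), ζ⟫ := by
      set R := fderiv ℝ U w - fderiv ℝ U z with hR
      set Q := fderiv ℝ U w - fderiv ℝ U y with hQ
      have hRn : ‖R‖ ≤ κ := hDUz s hs'
      have hQn : ‖Q‖ ≤ C₂ * (s * ‖ζ‖) := hDUy s hs'
      have hsym : ⟪u, fderiv ℝ U z ζ⟫ = ⟪fderiv ℝ U z u, ζ⟫ := by
        have := hS u ζ
        simp only [ContinuousLinearMap.coe_coe] at this
        rw [this]
      have hVwu : V w = V y + u := by rw [hudef]; abel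
      -- the algebraic identity
      have e : ⟪V w, fderiv ℝ U w ζ⟫ - ⟪fderiv ℝ U w (V w), ζ⟫ -
          (⟪V y, fderiv ℝ U y ζ⟫ - ⟪fderiv ℝ U y (V y), ζ⟫) =
          (⟪u, R ζ⟫ - ⟪R u, ζ⟫) + (⟪V y, Q ζ⟫ - ⟪Q (V y), ζ⟫) := by
        have eR : fderiv ℝ U w = fderiv ℝ U z + R := by rw [hR]; abel
        have eQ : fderiv ℝ U w = fderiv ℝ U y + Q := by rw [hQ]; abel
        rw [hVwu]
        simp only [inner_add_left, map_add]
        rw [eQ]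
        simp only [add_apply, inner_add_left, inner_add_right]
        have e3 : ⟪u, (fderiv ℝ U y + Q) ζ⟫ - ⟪(fderiv ℝ U y + Q) u, ζ⟫ = ⟪u, R ζ⟫ - ⟪R u, ζ⟫ := by
          have : fderiv ℝ U y + Q = fderiv ℝ U z + R := by rw [← eQ, eR]
          rw [this]
          simp only [add_apply, inner_add_left, inner_add_right]
          linarith [hsym]
        simp only [add_apply, inner_add_left, inner_add_right] at e3
        linarith [e3]
      have hb1 : |⟪u, R ζ⟫| ≤ (‖A‖ + ρ) * κ * T := by
        calc |⟪u, R ζ⟫| ≤ ‖u‖ * ‖R ζ‖ := abs_real_inner_le_norm _ _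
          _ ≤ ((‖A‖ + ρ) * (s * ‖ζ‖)) * (κ * ‖ζ‖) :=
              mul_le_mul hun ((R.le_opNorm ζ).trans (mul_le_mul_of_nonneg_right hRn (norm_nonneg _)))
                (norm_nonneg _) (mul_nonneg (add_nonneg (norm_nonneg _) hρpos.le)
                  (mul_nonneg hs.1.le (norm_nonneg _)))
          _ = (‖A‖ + ρ) * κ * T := by rw [hT]; ring
      have hb2 : |⟪R u, ζ⟫| ≤ (‖A‖ + ρ) * κ * T := by
        calc |⟪R u, ζ⟫| ≤ ‖R u‖ * ‖ζ‖ := abs_real_inner_le_norm _ _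
          _ ≤ (κ * ((‖A‖ + ρ) * (s * ‖ζ‖))) * ‖ζ‖ :=
              mul_le_mul_of_nonneg_right ((R.le_opNorm _).trans
                (mul_le_mul hRn hun (norm_nonneg _) hκpos.le)) (norm_nonneg _)
          _ = (‖A‖ + ρ) * κ * T := by rw [hT]; ring
      have hb3 : |⟪V y, Q ζ⟫| ≤ C₂ * ‖V y‖ * T := by
        calc |⟪V y, Q ζ⟫| ≤ ‖V y‖ * ‖Q ζ‖ := abs_real_inner_le_norm _ _
          _ ≤ ‖V y‖ * ((C₂ * (s * ‖ζ‖)) * ‖ζ‖) :=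
              mul_le_mul_of_nonneg_left ((Q.le_opNorm ζ).trans
                (mul_le_mul_of_nonneg_right hQn (norm_nonneg _))) (norm_nonneg _)
          _ = C₂ * ‖V y‖ * T := by rw [hT]; ring
      have hb4 : |⟪Q (V y), ζ⟫| ≤ C₂ * ‖V y‖ * T := by
        calc |⟪Q (V y), ζ⟫| ≤ ‖Q (V y)‖ * ‖ζ‖ := abs_real_inner_le_norm _ _
          _ ≤ ((C₂ * (s * ‖ζ‖)) * ‖V y‖) * ‖ζ‖ :=
              mul_le_mul_of_nonneg_right ((Q.le_opNorm _).trans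
                (mul_le_mul_of_nonneg_right hQn (norm_nonneg _))) (norm_nonneg _)
          _ = C₂ * ‖V y‖ * T := by rw [hT]; ring
      have e1 := (abs_le.1 hb1).1
      have e2 := (abs_le.1 hb2).2
      have e3 := (abs_le.1 hb3).1
      have e4 := (abs_le.1 hb4).2
      linarith [e, e1, e2, e3, e4]
    -- budget
    have hbudget : |2 * γ - 1| * ρ + 2 * (‖A‖ + ρ) * κ ≤ 2 * ν := by
      have hA0 : 0 ≤ ‖A‖ := norm_nonneg _
      have h3 : 2 * (‖A‖ + ρ) * κ ≤ ν := by
        rw [hκ, show 2 * (‖A‖ + ρ) * (ν / (4 * (‖A‖ + 2))) = ν * ((‖A‖ + ρ) / (2 * (‖A‖ + 2))) by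
          field_simp; ring]
        have : (‖A‖ + ρ) / (2 * (‖A‖ + 2)) ≤ 1 := by
          rw [div_le_one (by positivity)]; linarith
        calc ν * ((‖A‖ + ρ) / (2 * (‖A‖ + 2))) ≤ ν * 1 := mul_le_mul_of_nonneg_left this hν.le
          _ = ν := mul_one _
      linarith
    have hTb : (|2 * γ - 1| * ρ + 2 * (‖A‖ + ρ) * κ) * T ≤ 2 * ν * T :=
      mul_le_mul_of_nonneg_right hbudget hTnn
    have e3 : s * q = (2 * γ - 1) * (s * ⟪A ζ, ζ⟫) - 2 * ν * T - 2 * C₂ * ‖V y‖ * T := by rw [hq, hT]; ring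
    rw [e3]
    have e4 : (|2 * γ - 1| * ρ + 2 * (‖A‖ + ρ) * κ) * T = |2 * γ - 1| * ρ * T + 2 * (‖A‖ + ρ) * κ * T := by
      ring
    have e5 : (2 * (‖A‖ + ρ) * κ + 2 * C₂ * ‖V y‖) * T = 2 * (‖A‖ + ρ) * κ * T + 2 * C₂ * ‖V y‖ * T := by
      ring
    linarith [h1, h2, hTb, e4, e5]
  -- integrate: `ψ s = g s - L₀ s - s²/2 · q` is nondecreasing on `[0, 1]`
  set ψ : ℝ → ℝ := fun s => g s - L₀ * s - s ^ 2 / 2 * q with hψ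
  have hψ' : ∀ s, HasDerivAt ψ (fderiv ℝ Hb (y + s • ζ) ζ - L₀ - s * q) s := by
    intro s
    have h1 : HasDerivAt (fun s : ℝ => L₀ * s) L₀ s := by
      simpa using (hasDerivAt_id s).const_mul L₀
    have h2 : HasDerivAt (fun s : ℝ => s ^ 2 / 2 * q) (s * q) s := by
      have := ((hasDerivAt_pow 2 s).div_const 2).mul_const q
      refine this.congr_deriv ?_
      push_cast
      ring
    have := ((hg' s).sub h1).sub h2
    refine this.congr_deriv ?_
    ring
  have hmono : MonotoneOn ψ (Icc 0 1) := by
    refine monotoneOn_of_hasDerivWithinAt_nonneg (convex_Icc 0 1)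
      (fun s _ => (hψ' s).continuousAt.continuousWithinAt) (fun s _ => (hψ' s).hasDerivWithinAt) ?_
    intro s hs
    rw [interior_Icc] at hs
    linarith [hlow s hs]
  have h01 := hmono (left_mem_Icc.2 zero_le_one) (right_mem_Icc.2 zero_le_one) zero_le_one
  simp only [hψ, hg, zero_smul, add_zero, one_smul, one_pow, mul_zero, mul_one, sub_zero] at h01
  simp only [hq] at h01
  norm_num at h01
  show Hb y + L₀ + (1 / 2 * ((2 * γ - 1) * ⟪A ζ, ζ⟫) - (ν + C₂ * ‖V y‖) * ‖ζ‖ ^ 2) ≤ Hb (y + ζ)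
  linarith [h01]

/-! ### The bump lemma -/

/-- **Bump lemma.**  Let `φ : ℝ → ℝ` satisfy `|φ(σ) − φ(σ')| ≤ ℓ|σ − σ'|` for `σ, σ' ∈ [0, b]` and `|φ(σ)| ≤ C₁σ²`
there, with `C₁ b ≤ ℓ`, `ℓ > 0`.  For `σ_* ∈ [0, b]` with `M := |φ(σ_*)|`: the interval `[σ_* − M/(2ℓ), σ_*]` lies in
`[σ_*/2, σ_*]` and `|φ| ≥ M/2` on it. [folklore] -/
theorem bump_of_sq_bound {φ : ℝ → ℝ} {ℓ C₁ b σs : ℝ} (hℓ : 0 < ℓ) (hC₁ : 0 ≤ C₁) (hb : C₁ * b ≤ ℓ)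
    (hlip : ∀ σ ∈ Icc (0 : ℝ) b, ∀ σ' ∈ Icc (0 : ℝ) b, |φ σ - φ σ'| ≤ ℓ * |σ - σ'|)
    (hsq : ∀ σ ∈ Icc (0 : ℝ) b, |φ σ| ≤ C₁ * σ ^ 2) (hσs : σs ∈ Icc (0 : ℝ) b) :
    σs / 2 ≤ σs - |φ σs| / (2 * ℓ) ∧
      ∀ σ ∈ Icc (σs - |φ σs| / (2 * ℓ)) σs, |φ σs| / 2 ≤ |φ σ| := by
  have hM := hsq σs hσs
  -- `M ≤ C₁ σs² ≤ C₁ b σs ≤ ℓ σs`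
  have hMσ : |φ σs| ≤ ℓ * σs := by
    have h1 : C₁ * σs ^ 2 ≤ C₁ * b * σs := by
      have := mul_le_mul_of_nonneg_left hσs.2 (mul_nonneg hC₁ hσs.1)
      nlinarith [this]
    have h2 : C₁ * b * σs ≤ ℓ * σs := mul_le_mul_of_nonneg_right hb hσs.1
    linarith
  have hhalf : σs / 2 ≤ σs - |φ σs| / (2 * ℓ) := by
    have : |φ σs| / (2 * ℓ) ≤ σs / 2 := by
      rw [div_le_div_iff₀ (by positivity) (by norm_num)]; nlinarith [hMσ]
    linarith
  refine ⟨hhalf, fun σ hσ => ?_⟩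
  have hσ0 : 0 ≤ σ := by linarith [hσ.1, hhalf, hσs.1]
  have hσb : σ ≤ b := hσ.2.trans hσs.2
  have h1 := hlip σs hσs σ ⟨hσ0, hσb⟩
  have h2 : ℓ * |σs - σ| ≤ |φ σs| / 2 := by
    rw [abs_of_nonneg (by linarith [hσ.2])]
    have : σs - σ ≤ |φ σs| / (2 * ℓ) := by linarith [hσ.1]
    calc ℓ * (σs - σ) ≤ ℓ * (|φ σs| / (2 * ℓ)) := mul_le_mul_of_nonneg_left this hℓ.le
      _ = |φ σs| / 2 := by field_simp
  have h3 : |φ σs| - |φ σ| ≤ |φ σs - φ σ| := abs_sub_abs_le_abs_sub _ _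
  linarith

end Summit.NavierStokesRegularity.NavierStokesRegularity.Theorems.PowerGaugeEulerLiouville.NodalContinuum
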